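import Summits.ValiantsHypothesis.ValiantsHypothesis.Theorems.SymPencilSdcPerFourKernelPackage
import Summits.ValiantsHypothesis.ValiantsHypothesis.Theorems.SymPencilPerFourHessianBlocks
import Summits.ValiantsHypothesis.ValiantsHypothesis.Theorems.SymPencilSdcPerFourTrichotomyGlue

/-!
# Route `SymPencil` — `sdc(per_4) ≥ 25` from the `7`-dimensional trichotomy alone
# (`--supports` stmt-ValiantsHypothesis-5674 `SdcSuperquadratic`; rung currency only)

**Theorem** (`twentyFive_le_of_seven_trichotomy`).  Over a field of characteristic `0`: IF every
`7`-dimensional linear subspace of `Sing Z(per_4)` has a detecting pair of rows, or of columns, or is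
a cross `row l ∪ column c` (the trichotomy `T7` of prover val-width-5676-p2 g3, files
`SymPencilBoxFourSeven*` / `SymPencilBoxFourCross*`, taken here as a HYPOTHESIS in its announced
shape), THEN every symmetric affine determinantal representation of `per_4` has size `m ≥ 25`.

No `6`-dimensional classification is needed (its naive form is false:
`SymPencilPerFourSixDimExotic.not_sixDim_trichotomy`).  Proof, for `m ≤ 24`, on the TWO-SIDED
kernel package of val-width-5674-p2 (`SymPencilSdcPerFourKernelPackage.kernel_package₂…`:
`V ⊆ Sing`, `dim V + r = 16`, `2r + 1 ≤ m`, `dim V ≤ 8`, and for `d ≥ m − 1 − 2r` both a `d`-square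
family in `y` for each base point `u` (S1) and a `d`-square family in `u` for each `y ∈ V` (S2)):

* `r = 8`, `dim V = 8`, `d = 7 < 8`: two-row block (`SymPencilBoxFourEquality.two_rows_or_two_cols`)
  and `SymPencilSdcSuperquadraticStubBlockRankFour.not_sum_sq_family_of_card_lt` (S1);
* `r = 9`, `dim V = 7`, `d = 5`: `T7` and the detecting / cross rank counts `2·7 > 5 + 8`
  (`SymPencilSdcPerFourTrichotomyGlue.not_sqFamily_seven_of_trichotomy`, S1);
* `r = 10, 11`, `dim V = 6, 5`, `d = 3, 1`: the swapped reading `rank Hess per_4(y) ≤ 3` on `V`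
  forces `dim V ≤ 4` (`SymPencilPerFourHessianBlocks.finrank_le_four_of_sum_sq_swap`, S2).

At `m = 25` both `(r, d) = (8, 8)` and `(9, 6)` pass every single-base-point rank count (the block
form has rank `8`, the cross form rank `6`): the ceiling of this method, as recorded in the lane's
NEXT-RUNG notes.  Honest framing: a conditional rung; `sdc(per_4) ≥ 23` is the tree's unconditional
value (`SymPencilSdcPerFourTwentyThree`); the crux `SdcSuperquadratic` and `VP ≠ VNP` are untouched.
No definitions, no named facts. [folklore]
-/

noncomputable section

-- single-conjunct layout: Sub = Summit, duplicated namespace component intended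
set_option linter.dupNamespace false

namespace Summit.ValiantsHypothesis.ValiantsHypothesis.Theorems.SymPencilSdcPerFourTwentyFiveOfSeven

open MvPolynomial Module
open Literature.Computability.AlgebraicComplexity
open Summit.ValiantsHypothesis.ValiantsHypothesis.Theorems.SymPencilSdcPerFourKernelPackage
open Summit.ValiantsHypothesis.ValiantsHypothesis.Theorems.SymPencilPerFourHessianBlocks
open Summit.ValiantsHypothesis.ValiantsHypothesis.Theorems.SymPencilSdcSuperquadraticStubBlockRankFour
open Summit.ValiantsHypothesis.ValiantsHypothesis.Theorems.SymPencilBoxFourEquality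
open Summit.ValiantsHypothesis.ValiantsHypothesis.Theorems.SymPencilSdcPerFourTrichotomyGlue

variable {K : Type*} [Field K] [CharZero K]

/-- **No symmetric affine determinantal representation of `per_4` of size `≤ 24`, given `T7`.**
[folklore] -/
theorem false_of_le_twentyFour_of_seven_trichotomy
    (T7 : ∀ W : Submodule K (Fin 4 × Fin 4 → K),
      (∀ x ∈ W, ∀ (r c : Fin 3 → Fin 4), Function.Injective r → Function.Injective c →
        ((Matrix.of fun i j => x (i, j)).submatrix r c).permanent = 0) →
      finrank K W = 7 →
      (∃ p q : Fin 4, p ≠ q ∧ ∀ x ∈ W, (∀ j, x (p, j) = 0) → (∀ j, x (q, j) = 0) → x = 0) ∨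
      (∃ p q : Fin 4, p ≠ q ∧ ∀ x ∈ W, (∀ i, x (i, p) = 0) → (∀ i, x (i, q) = 0) → x = 0) ∨
      (∃ l c : Fin 4, ∀ x, x ∈ W ↔ ∀ i j : Fin 4, i ≠ l → j ≠ c → x (i, j) = 0))
    {m : ℕ} (hm : m ≤ 24) {A : Matrix (Fin m) (Fin m) (MvPolynomial (Fin 4 × Fin 4) K)}
    (hS : A.IsSymm) (hA : IsAffineDetRepr (perPoly (Fin 4) K) A) : False := by
  obtain ⟨r, V, hVr, hrm, hV8, hV3, hsq, hswap⟩ :=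
    kernel_package₂_of_isSymm_isAffineDetRepr_perPoly_four K hS hA
  have hr : r = 8 ∨ r = 9 ∨ r = 10 ∨ r = 11 ∨ 12 ≤ r := by omega
  rcases hr with rfl | rfl | rfl | rfl | h12
  · -- `dim V = 8`, `d = 7`: two-row block, no family of `< 8` squares
    have hV : finrank K V = 8 := by omega
    obtain ⟨c, hc⟩ := hsq 7 (by omega)
    exact not_sum_sq_family_of_card_lt (ι := Fin 7) (by rw [Fintype.card_fin]; norm_num) V hV
      (two_rows_or_two_cols V hV3 hV) fun u => by
        obtain ⟨Λ, hΛ⟩ := hc u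
        exact ⟨c, Λ, hΛ⟩
  · -- `dim V = 7`, `d = 5`: the trichotomy and the detecting / cross rank counts
    obtain ⟨c, hc⟩ := hsq 5 (by omega)
    exact not_sqFamily_seven_of_trichotomy T7 (k := 5) le_rfl V hV3 (by omega) c hc
  · -- `dim V = 6`, `d = 3`: `rank Hess per_4 ≤ 3` on `V` forces `dim V ≤ 4`
    obtain ⟨c, hc⟩ := hswap 3 (by omega)
    have h4 := finrank_le_four_of_sum_sq_swap (ι := Fin 3) (by rw [Fintype.card_fin]; norm_num) V
      fun y hy => by
        obtain ⟨Λ, hΛ⟩ := hc y hy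
        exact ⟨c, Λ, hΛ⟩
    omega
  · -- `dim V = 5`, `d = 1`
    obtain ⟨c, hc⟩ := hswap 1 (by omega)
    have h4 := finrank_le_four_of_sum_sq_swap (ι := Fin 1) (by rw [Fintype.card_fin]; norm_num) V
      fun y hy => by
        obtain ⟨Λ, hΛ⟩ := hc y hy
        exact ⟨c, Λ, hΛ⟩
    omega
  · omega

/-- **`sdc(per_4) ≥ 25 ⟸ T7`** (characteristic `0`): given the `7`-dimensional trichotomy, every
symmetric affine determinantal representation of `per_4` has size `≥ 25`. [folklore] -/
theorem twentyFive_le_of_seven_trichotomy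
    (T7 : ∀ W : Submodule K (Fin 4 × Fin 4 → K),
      (∀ x ∈ W, ∀ (r c : Fin 3 → Fin 4), Function.Injective r → Function.Injective c →
        ((Matrix.of fun i j => x (i, j)).submatrix r c).permanent = 0) →
      finrank K W = 7 →
      (∃ p q : Fin 4, p ≠ q ∧ ∀ x ∈ W, (∀ j, x (p, j) = 0) → (∀ j, x (q, j) = 0) → x = 0) ∨
      (∃ p q : Fin 4, p ≠ q ∧ ∀ x ∈ W, (∀ i, x (i, p) = 0) → (∀ i, x (i, q) = 0) → x = 0) ∨
      (∃ l c : Fin 4, ∀ x, x ∈ W ↔ ∀ i j : Fin 4, i ≠ l → j ≠ c → x (i, j) = 0))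
    {m : ℕ} {A : Matrix (Fin m) (Fin m) (MvPolynomial (Fin 4 × Fin 4) K)} (hS : A.IsSymm)
    (hA : IsAffineDetRepr (perPoly (Fin 4) K) A) : 25 ≤ m := by
  by_contra h
  exact false_of_le_twentyFour_of_seven_trichotomy T7 (by omega) hS hA

open Summit.ValiantsHypothesis.ValiantsHypothesis.Theorems.SymPencilPerFourDetectingRadical
  Summit.ValiantsHypothesis.ValiantsHypothesis.Theorems.SymPencilPerFourCrossRadical in
/-- **The same with the WEAK third alternative** ("`W` lies inside a cross" instead of "is a
cross") — the shape produced directly by `SymPencilBoxFourCrossOf.le_cross_of_no_detecting`; it is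
all the rank count needs. [folklore] -/
theorem false_of_le_twentyFour_of_seven_trichotomy_le
    (T7 : ∀ W : Submodule K (Fin 4 × Fin 4 → K),
      (∀ x ∈ W, ∀ (r c : Fin 3 → Fin 4), Function.Injective r → Function.Injective c →
        ((Matrix.of fun i j => x (i, j)).submatrix r c).permanent = 0) →
      finrank K W = 7 →
      (∃ p q : Fin 4, p ≠ q ∧ ∀ x ∈ W, (∀ j, x (p, j) = 0) → (∀ j, x (q, j) = 0) → x = 0) ∨
      (∃ p q : Fin 4, p ≠ q ∧ ∀ x ∈ W, (∀ i, x (i, p) = 0) → (∀ i, x (i, q) = 0) → x = 0) ∨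
      (∃ l c : Fin 4, ∀ x ∈ W, ∀ i j : Fin 4, i ≠ l → j ≠ c → x (i, j) = 0))
    {m : ℕ} (hm : m ≤ 24) {A : Matrix (Fin m) (Fin m) (MvPolynomial (Fin 4 × Fin 4) K)}
    (hS : A.IsSymm) (hA : IsAffineDetRepr (perPoly (Fin 4) K) A) : False := by
  obtain ⟨r, V, hVr, hrm, hV8, hV3, hsq, hswap⟩ :=
    kernel_package₂_of_isSymm_isAffineDetRepr_perPoly_four K hS hA
  have hr : r = 8 ∨ r = 9 ∨ r = 10 ∨ r = 11 ∨ 12 ≤ r := by omega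
  rcases hr with rfl | rfl | rfl | rfl | h12
  · have hV : finrank K V = 8 := by omega
    obtain ⟨c, hc⟩ := hsq 7 (by omega)
    exact not_sum_sq_family_of_card_lt (ι := Fin 7) (by rw [Fintype.card_fin]; norm_num) V hV
      (two_rows_or_two_cols V hV3 hV) fun u => by
        obtain ⟨Λ, hΛ⟩ := hc u
        exact ⟨c, Λ, hΛ⟩
  · obtain ⟨c, hc⟩ := hsq 5 (by omega)
    have h7 : finrank K V = 7 := by omega
    have hlt : Fintype.card (Fin 5) + 8 < 2 * finrank K V := by rw [Fintype.card_fin, h7]; norm_num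
    rcases T7 V hV3 h7 with hr | hc' | hX
    · exact not_sqFamily_of_detecting V hV3 (Or.inl hr) hlt c hc
    · exact not_sqFamily_of_detecting V hV3 (Or.inr hc') hlt c hc
    · exact not_sqFamily_of_cross V hX hlt c hc
  · obtain ⟨c, hc⟩ := hswap 3 (by omega)
    have h4 := finrank_le_four_of_sum_sq_swap (ι := Fin 3) (by rw [Fintype.card_fin]; norm_num) V
      fun y hy => by
        obtain ⟨Λ, hΛ⟩ := hc y hy
        exact ⟨c, Λ, hΛ⟩
    omega
  · obtain ⟨c, hc⟩ := hswap 1 (by omega)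
    have h4 := finrank_le_four_of_sum_sq_swap (ι := Fin 1) (by rw [Fintype.card_fin]; norm_num) V
      fun y hy => by
        obtain ⟨Λ, hΛ⟩ := hc y hy
        exact ⟨c, Λ, hΛ⟩
    omega
  · omega

/-- **`sdc(per_4) ≥ 25 ⟸ T7` (weak cross alternative).** [folklore] -/
theorem twentyFive_le_of_seven_trichotomy_le
    (T7 : ∀ W : Submodule K (Fin 4 × Fin 4 → K),
      (∀ x ∈ W, ∀ (r c : Fin 3 → Fin 4), Function.Injective r → Function.Injective c →
        ((Matrix.of fun i j => x (i, j)).submatrix r c).permanent = 0) →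
      finrank K W = 7 →
      (∃ p q : Fin 4, p ≠ q ∧ ∀ x ∈ W, (∀ j, x (p, j) = 0) → (∀ j, x (q, j) = 0) → x = 0) ∨
      (∃ p q : Fin 4, p ≠ q ∧ ∀ x ∈ W, (∀ i, x (i, p) = 0) → (∀ i, x (i, q) = 0) → x = 0) ∨
      (∃ l c : Fin 4, ∀ x ∈ W, ∀ i j : Fin 4, i ≠ l → j ≠ c → x (i, j) = 0))
    {m : ℕ} {A : Matrix (Fin m) (Fin m) (MvPolynomial (Fin 4 × Fin 4) K)} (hS : A.IsSymm)
    (hA : IsAffineDetRepr (perPoly (Fin 4) K) A) : 25 ≤ m := by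
  by_contra h
  exact false_of_le_twentyFour_of_seven_trichotomy_le T7 (by omega) hS hA

end Summit.ValiantsHypothesis.ValiantsHypothesis.Theorems.SymPencilSdcPerFourTwentyFiveOfSeven

end
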